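import Literature.Barriers.AtomisticToContinuum.DisorderedHarmonicChainAdjoint
import Literature.Barriers.AtomisticToContinuum.DisorderedHarmonicChainTransfer
import HarnessLib

/-!
# Narrowed barrier `DisorderedHarmonicChainNarrow` (barrier audit of `DisorderedHarmonicChain`, 2026-08-15)

`Literature/Barriers/AtomisticToContinuum/` (D-0021 barrier catalogue), sub-problem `FouriersLaw`.
Companion of `DisorderedHarmonicChain.lean`, whose BARRIER block rides on the named fact
`AjankiHuveneers2011_scaling` (O. Ajanki, F. Huveneers, *Rigorous scaling law for the heat current in
disordered harmonic chain*, CMP **301** (2011) 841–883, arXiv:1003.1076, Thm 1.1: for i.i.d. masses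
with a compactly supported `C¹` density in `(0, ∞)`, white-noise baths and fixed walls,
`K(T_1 - T_n)n^{-3/2} ≤ E J_n ≤ K'(T_1 - T_n)n^{-3/2}`). The audit (refuter, 2026-08-15) found the
vendored statement FAITHFUL to the printed theorem (hypotheses = the §2 density class; the cluster
`…Spectral/…Adjoint.lean` reduces it to the transmission-integral form the paper proves), but the
catalogued `technique_class` — "quenched-disorder random-masses anderson-localization …
(disorder as a substitute for anharmonicity)" — broader than what the theorem and its mechanism
(`γ(ω) ≍ σ²ω²`) quantify over, in one formalisable respect: INDEPENDENCE (and light tails) of the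
masses is load-bearing. This file records the sharpened barrier `DisorderedHarmonicChainNarrow`
with both conjuncts PROVED (`DisorderedHarmonicChainNarrow_holds`):

1. the catalogued fact, reduced to the single spectral statement
   `AjankiHuveneers2011_spectralScaling` (the cluster's capstone
   `AjankiHuveneers2011_scaling_of_spectralScaling`, `…Adjoint.lean`);
2. the opposite extreme of the joint law with the SAME marginals: comonotone (all-equal) masses
   `M_1 = ⋯ = M_n = c`, `c ∈ [a, b] ⊂ (0, ∞)` — for every `n ≥ 1` and every realisation the
   stationary current is `≥ G₀(a, b, λ)(T_L - T_R)` with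
   `G₀ = 3(√3 - 1)λ²√a/(8π(1 + 3λ²b)²)` (`comonotone_clLeftFlux_ge`): exponent `0`, not `-3/2`.
   Under the catalogued fact the product coupling is eventually strictly below that level
   (`AjankiHuveneers2011_scaling.iid_eventually_lt_comonotone`).

Between the two extremes the literature read for the audit (page/section hits in the BARRIER block
of `DisorderedHarmonicChainNarrow`) predicts TUNABLE exponents — in particular the Fourier-like
`J ≍ N^{-1}` in a purely harmonic `d = 1` chain between the standard white-noise baths with fixed
walls, from long-range correlated isotopic disorder with power spectrum `W(μ) ∼ μ`
[HerreragonzalezIzrailevTessieri2015]; and, outside the density class, from heavy-tailed weak-link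
disorder [AmirOregImry2018, AshEtAl2020]; in `d = 3` mass disorder alone is predicted and
numerically observed to give `J ∼ N^{-1}` [ChaudhuriEtAl2010]. None of these is a theorem; all
are mode-counting statements (ballistic low modes in a window set by the localisation length), not
local-equilibrium statements — for the i.i.d. chain the bulk temperature profile is in fact frozen
on every time scale [BernardinHuveneersOlla2018].

## The proof of conjunct (2) (all steps here; inputs from the cluster)

* `ahD_const_quadInvariant`: for a diagonal symbol constant `= δ` on the indices used, the
  continuant recursion `D_{j+2} = δD_{j+1} - D_j` conserves `D_{j+1}² - δD_{j+1}D_j + D_j²`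
  (`= 1` for both initial vectors `e₁`, `e₂`); completing the square, `(4 - δ²)D_j² ≤ 4`
  (`sq_le_of_quadForm`). For equal masses `c`, `δ = 2 - cω²` and `4 - δ² = x(4 - x)`, `x = cω²`:
  inside the band the transfer-matrix elements stay bounded, `x(4-x)D_j(e_i)² ≤ 4`
  (`chainD_const_sq_le`) — no localisation.
* `normSq_det_clImpedance_pos`: `|det Z_n(ω)|² > 0` for `ω ≠ 0` (real and imaginary parts of
  `v_nᵀQ_nv_1` cannot vanish together since `det Q_n = 1`, `chainD_casorati`).
* `clSpectralIntegrand_const_ge`: on the window `1 ≤ cω² ≤ 3`,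
  `|det Z_n|² ≤ 2(D_n(e₁)² + a⁴D_{n-1}(e₂)²) + 2a²(D_n(e₂)² + D_{n-1}(e₁)²) ≤ (8/3)(1 + a²)²`,
  `a = λcω`, `a² ≤ 3λ²c` (`normSq_det_clImpedance` of `…Transfer.lean`), hence
  `ω²/|det Z_n(ω)|² ≥ 3/(8c(1 + 3λ²c)²)` uniformly in `n`.
* `ballisticConst_le_clSpectralConductance`: integrating over the window
  `[1/√c, √3/√c]` (width `(√3 - 1)/√c`; the integrand is integrable on `ℝ`,
  `integrable_transmission` of `…CurrentProofs.lean`) gives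
  `𝒢_n(c,…,c; λ) = (λ²c²/π)∫ω²|det Z_n|⁻² ≥ G(c, λ) = 3(√3 - 1)λ²√c/(8π(1 + 3λ²c)²)` for all `n ≥ 1`.
* `comonotone_clLeftFlux_ge`: the Gaussian steady state (`CasherLebowitz1971_steadyState_holds`,
  `…SteadyState.lean`) and the transmission formula (`CasherLebowitz1971_currentFormula_holds`,
  `…CurrentProofs.lean`) turn this into `J_n(c,…,c) = (T_L - T_R)𝒢_n ≥ G₀(a,b,λ)(T_L - T_R)`.

## Design notes

* No named fact is introduced: `DisorderedHarmonicChainNarrow` is a `def … : Prop` proved in this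
  file; its conjunct (1) is stated as the implication from the paper's theorem proper so that the
  file does not depend on the open discharge of `AjankiHuveneers2011_spectralScaling`.
* The comonotone conjunct is deliberately stated realisation-wise (`∀ c ∈ [a, b]`), which is
  stronger than — and free of the measurability bookkeeping of — an average over the diagonal
  coupling `(s ↦ (s,…,s))_* ρ` of a one-site law `ρ` on `[a, b]`.
* Constants are explicit but not optimised (window `1 ≤ cω² ≤ 3` of the band `0 < cω² < 4`).
-/

noncomputable section

open MeasureTheory

namespace Literature.Barriers.AtomisticToContinuum.HeatConduction

open Literature.MathematicalPhysics.KineticTheory.HeatConduction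

/-! ### The homogeneous chain: a quadratic invariant of the constant-symbol recursion -/

/-- For a diagonal symbol equal to `δ` on the indices used, the continuant recursion
`D_{j+2} = δ D_{j+1} - D_j` conserves the quadratic form `D_{j+1}² - δ D_{j+1} D_j + D_j²`
(the norm form of `X² - δX + 1`; for `δ = 2cos θ` it is the conservation law behind
`D_j(e₁) = sin((j+1)θ)/sin θ`). [folklore] -/
theorem ahD_const_quadInvariant (d : ℕ → ℝ) (δ v₀ v₁ : ℝ) :
    ∀ k : ℕ, (∀ j, j ≤ k → d j = δ) →
      ahD d v₀ v₁ (k + 1) ^ 2 - δ * ahD d v₀ v₁ (k + 1) * ahD d v₀ v₁ k + ahD d v₀ v₁ k ^ 2 =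
        v₀ ^ 2 - δ * v₀ * v₁ + v₁ ^ 2
  | 0, hd => by
      have h0 : d 0 = δ := hd 0 le_rfl
      have h1 : ahD d v₀ v₁ (0 + 1) = d 0 * v₀ - v₁ := rfl
      rw [h1, ahD_zero, h0]
      ring
  | k + 1, hd => by
      have ih := ahD_const_quadInvariant d δ v₀ v₁ k (fun j hj => hd j (Nat.le_succ_of_le hj))
      have hk : d (k + 1) = δ := hd (k + 1) le_rfl
      rw [ahD_add_two, hk]
      linear_combination ih

/-- The quadratic form `q = u² - δuv + v²` controls both coordinates when `|δ| < 2`: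
`(4 - δ²)u² ≤ 4q` and `(4 - δ²)v² ≤ 4q` (complete the square). [folklore] -/
theorem sq_le_of_quadForm {δ u v q : ℝ} (h : u ^ 2 - δ * u * v + v ^ 2 = q) :
    (4 - δ ^ 2) * u ^ 2 ≤ 4 * q ∧ (4 - δ ^ 2) * v ^ 2 ≤ 4 * q := by
  constructor
  · nlinarith [sq_nonneg (2 * v - δ * u)]
  · nlinarith [sq_nonneg (2 * u - δ * v)]

/-- **Bounded continuants for the homogeneous chain inside the band** (no localisation for equal
masses): with `x = cω²`, every transfer-matrix element of the chain with all masses `c` obeys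
`x(4 - x)·D_j(e_i)² ≤ 4` for `j ≤ n` (i.e. `|D_j| ≤ 1/sin θ`, `2cos θ = 2 - cω²`). [folklore] -/
theorem chainD_const_sq_le {k : ℕ} (c ω : ℝ) (j : ℕ) (hj : j ≤ k + 1) :
    (c * ω ^ 2) * (4 - c * ω ^ 2) * chainD₁ (fun _ : Fin (k + 1) => c) ω j ^ 2 ≤ 4 ∧
      (c * ω ^ 2) * (4 - c * ω ^ 2) * chainD₂ (fun _ : Fin (k + 1) => c) ω j ^ 2 ≤ 4 := by
  set δ : ℝ := 2 - c * ω ^ 2 with hδ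
  have hd : ∀ i, i ≤ k → massDiag (fun _ : Fin (k + 1) => c) ω i = δ := by
    intro i hi
    simp only [massDiag, finExt_of_lt _ (Nat.lt_succ_of_le hi), hδ]
  have hx : (c * ω ^ 2) * (4 - c * ω ^ 2) = 4 - δ ^ 2 := by rw [hδ]; ring
  rw [hx]
  rcases Nat.eq_zero_or_pos j with rfl | hjpos
  · simp only [chainD₁, chainD₂, ahD_zero]
    constructor <;> nlinarith [sq_nonneg δ]
  · obtain ⟨i, rfl⟩ : ∃ i, j = i + 1 := ⟨j - 1, by omega⟩
    have hi : i ≤ k := by omega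
    have h1 := ahD_const_quadInvariant (massDiag (fun _ : Fin (k + 1) => c) ω) δ 1 0 i
      (fun l hl => hd l (hl.trans hi))
    have h2 := ahD_const_quadInvariant (massDiag (fun _ : Fin (k + 1) => c) ω) δ 0 1 i
      (fun l hl => hd l (hl.trans hi))
    have b1 := (sq_le_of_quadForm h1).1
    have b2 := (sq_le_of_quadForm h2).1
    simp only [chainD₁, chainD₂]
    constructor
    · nlinarith [b1]
    · nlinarith [b2]

/-- `|det Z_n(ω)|² > 0` for `ω ≠ 0`, `λ ≠ 0` and positive end masses: the real and imaginary parts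
of `det Z_n = v_nᵀ Q_n v_1` cannot vanish together because `det Q_n = 1`. [folklore] -/
theorem normSq_det_clImpedance_pos {k : ℕ} (m : Fin (k + 1) → ℝ) {lam ω : ℝ} (hlam : lam ≠ 0)
    (hω : ω ≠ 0) (h0 : 0 < m 0) (hl : 0 < m (Fin.last k)) :
    0 < Complex.normSq (clImpedance m lam ω).det := by
  rw [normSq_det_clImpedance]
  have hcas := chainD_casorati m ω k
  set α : ℝ := ω * lam * m 0 with hα
  set β : ℝ := ω * lam * m (Fin.last k) with hβ
  set P := chainD₁ m ω (k + 1)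
  set Q := chainD₂ m ω k
  set R := chainD₂ m ω (k + 1)
  set S := chainD₁ m ω k
  have hαβ : 0 < α * β := by
    have hωl : 0 < (ω * lam) ^ 2 := by positivity
    have : α * β = (ω * lam) ^ 2 * (m 0 * m (Fin.last k)) := by rw [hα, hβ]; ring
    rw [this]
    positivity
  by_contra hneg
  have hneg : (P + α * β * Q) ^ 2 + (α * R - β * S) ^ 2 ≤ 0 := not_lt.mp hneg
  have hre : P + α * β * Q = 0 := by
    nlinarith [sq_nonneg (P + α * β * Q), sq_nonneg (α * R - β * S)]
  have him : α * R - β * S = 0 := by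
    nlinarith [sq_nonneg (P + α * β * Q), sq_nonneg (α * R - β * S)]
  have key : α * β + (α * β) ^ 2 * Q ^ 2 + β ^ 2 * S ^ 2 = 0 := by
    linear_combination (-(α * β)) * hcas + (α * β * Q) * hre - (β * S) * him
  nlinarith [sq_nonneg (α * β * Q), sq_nonneg (β * S)]

/-! ### The homogeneous chain conducts ballistically: an `n`-uniform lower bound on `𝒢_n(c,…,c; λ)` -/

/-- **Pointwise lower bound on the transmission integrand of the homogeneous chain in the band
`1 ≤ cω² ≤ 3`**: `ω²/|det Z_n(ω)|² ≥ 3/(8c(1 + 3λ²c)²)`, uniformly in `n` (from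
`|D_j| ≤ 2/√(x(4-x)) ≤ 2/√3` and `|det Z_n|² ≤ 2(D_n(e₁)² + a⁴D_{n-1}(e₂)²) + 2a²(D_n(e₂)² + D_{n-1}(e₁)²)`,
`a = λcω`, `a² ≤ 3λ²c`). [folklore] -/
theorem clSpectralIntegrand_const_ge {k : ℕ} {c lam ω : ℝ} (hc : 0 < c) (hlam : 0 < lam)
    (hω : 0 < ω) (hx1 : 1 ≤ c * ω ^ 2) (hx3 : c * ω ^ 2 ≤ 3) :
    3 / (8 * c * (1 + 3 * lam ^ 2 * c) ^ 2) ≤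
      ω ^ 2 / Complex.normSq (clImpedance (fun _ : Fin (k + 1) => c) lam ω).det := by
  have hpos := normSq_det_clImpedance_pos (fun _ : Fin (k + 1) => c) hlam.ne' hω.ne' hc hc
  obtain ⟨hP, hR⟩ := chainD_const_sq_le (k := k) c ω (k + 1) le_rfl
  obtain ⟨hS, hQ⟩ := chainD_const_sq_le (k := k) c ω k (Nat.le_succ k)
  set P := chainD₁ (fun _ : Fin (k + 1) => c) ω (k + 1)
  set Q := chainD₂ (fun _ : Fin (k + 1) => c) ω k
  set R := chainD₂ (fun _ : Fin (k + 1) => c) ω (k + 1)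
  set S := chainD₁ (fun _ : Fin (k + 1) => c) ω k
  set x : ℝ := c * ω ^ 2 with hx
  have hx4 : 3 ≤ x * (4 - x) := by nlinarith
  have hP' : 3 * P ^ 2 ≤ 4 := le_trans (mul_le_mul_of_nonneg_right hx4 (sq_nonneg _)) hP
  have hQ' : 3 * Q ^ 2 ≤ 4 := le_trans (mul_le_mul_of_nonneg_right hx4 (sq_nonneg _)) hQ
  have hR' : 3 * R ^ 2 ≤ 4 := le_trans (mul_le_mul_of_nonneg_right hx4 (sq_nonneg _)) hR
  have hS' : 3 * S ^ 2 ≤ 4 := le_trans (mul_le_mul_of_nonneg_right hx4 (sq_nonneg _)) hS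
  set a : ℝ := ω * lam * c with ha
  have ha2 : a ^ 2 ≤ 3 * lam ^ 2 * c := by
    have : a ^ 2 = lam ^ 2 * c * (c * ω ^ 2) := by rw [ha]; ring
    rw [this]
    nlinarith [mul_pos (pow_pos hlam 2) hc]
  have ha2nn : 0 ≤ a ^ 2 := sq_nonneg a
  have hN : Complex.normSq (clImpedance (fun _ : Fin (k + 1) => c) lam ω).det =
      (P + a * a * Q) ^ 2 + (a * R - a * S) ^ 2 := by
    rw [normSq_det_clImpedance]
  -- `3·|det Z|² ≤ 8 (1 + a²)²`
  have h3N : 3 * Complex.normSq (clImpedance (fun _ : Fin (k + 1) => c) lam ω).det ≤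
      8 * (1 + a ^ 2) ^ 2 := by
    rw [hN]
    have e1 : (P + a * a * Q) ^ 2 ≤ 2 * P ^ 2 + 2 * (a ^ 2) ^ 2 * Q ^ 2 := by
      nlinarith [sq_nonneg (P - a * a * Q)]
    have e2 : (a * R - a * S) ^ 2 ≤ 2 * a ^ 2 * R ^ 2 + 2 * a ^ 2 * S ^ 2 := by
      nlinarith [sq_nonneg (a * R + a * S)]
    nlinarith [e1, e2, hP', hQ', hR', hS', ha2nn, mul_nonneg ha2nn ha2nn,
      mul_le_mul_of_nonneg_left hQ' (mul_nonneg ha2nn ha2nn),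
      mul_le_mul_of_nonneg_left hR' ha2nn, mul_le_mul_of_nonneg_left hS' ha2nn]
  have h1a : (1 + a ^ 2) ^ 2 ≤ (1 + 3 * lam ^ 2 * c) ^ 2 :=
    pow_le_pow_left₀ (by positivity) (by linarith) 2
  rw [div_le_div_iff₀ (by positivity) hpos]
  -- `3 · normSq ≤ ω² · 8c(1+3λ²c)²`
  calc 3 * Complex.normSq (clImpedance (fun _ : Fin (k + 1) => c) lam ω).det
      ≤ 8 * (1 + a ^ 2) ^ 2 := h3N
    _ ≤ 8 * (1 + 3 * lam ^ 2 * c) ^ 2 := by gcongr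
    _ = 1 * (8 * (1 + 3 * lam ^ 2 * c) ^ 2) := by ring
    _ ≤ (c * ω ^ 2) * (8 * (1 + 3 * lam ^ 2 * c) ^ 2) :=
        mul_le_mul_of_nonneg_right hx1 (by positivity)
    _ = ω ^ 2 * (8 * c * (1 + 3 * lam ^ 2 * c) ^ 2) := by ring

/-- The ballistic constant `G(c, λ) = 3(√3 - 1) λ² √c / (8π (1 + 3λ²c)²)`: an `n`-uniform lower
bound for the transmission integral of the homogeneous Casher–Lebowitz chain of mass `c`.
[folklore] -/
def ballisticConst (c lam : ℝ) : ℝ :=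
  3 * (Real.sqrt 3 - 1) * lam ^ 2 * Real.sqrt c / (8 * Real.pi * (1 + 3 * lam ^ 2 * c) ^ 2)

/-- The algebra of the ballistic constant: for `c = s²`,
`G(s², λ) = (λ²s²s²/π) · ((√3 - 1)/s) · (3/(8s²(1 + 3λ²s²)²))` (coefficient × window width ×
pointwise bound). [folklore] -/
theorem ballisticConst_sq (s lam : ℝ) (hs : 0 < s) :
    ballisticConst (s ^ 2) lam = lam ^ 2 * s ^ 2 * s ^ 2 / Real.pi *
      ((Real.sqrt 3 - 1) / s * (3 / (8 * s ^ 2 * (1 + 3 * lam ^ 2 * s ^ 2) ^ 2))) := by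
  unfold ballisticConst
  rw [Real.sqrt_sq hs.le]
  have hπ : Real.pi ≠ 0 := Real.pi_pos.ne'
  have hs0 : s ≠ 0 := hs.ne'
  have hden : (1 + 3 * lam ^ 2 * s ^ 2) ≠ 0 := by positivity
  field_simp

/-- `√3 - 1 > 0` (the width factor of the band window `[1/√c, √3/√c]`). [folklore] -/
theorem sqrt_three_sub_one_pos : (0 : ℝ) < Real.sqrt 3 - 1 := by
  rw [sub_pos, show (1 : ℝ) = Real.sqrt 1 from Real.sqrt_one.symm]
  exact Real.sqrt_lt_sqrt zero_le_one (by norm_num)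

/-- `G(c, λ) > 0` for `c, λ > 0`. [folklore] -/
theorem ballisticConst_pos {c lam : ℝ} (hc : 0 < c) (hlam : 0 < lam) : 0 < ballisticConst c lam := by
  unfold ballisticConst
  have h3 : 0 < Real.sqrt 3 - 1 := sqrt_three_sub_one_pos
  have hsc : 0 < Real.sqrt c := Real.sqrt_pos.mpr hc
  positivity

/-- `G(c, λ)` is monotone in the obvious way: for `c ∈ [a, b] ⊂ (0, ∞)`, `G(a; b, λ) ≤ G(c, λ)` where
the left side uses `√a` upstairs and `b` downstairs. [folklore] -/
theorem ballisticConst_mono {a b c lam : ℝ} (ha : 0 < a) (hac : a ≤ c) (hcb : c ≤ b) (hlam : 0 < lam) :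
    3 * (Real.sqrt 3 - 1) * lam ^ 2 * Real.sqrt a / (8 * Real.pi * (1 + 3 * lam ^ 2 * b) ^ 2) ≤
      ballisticConst c lam := by
  unfold ballisticConst
  have h3 : 0 < Real.sqrt 3 - 1 := sqrt_three_sub_one_pos
  have hc : 0 < c := ha.trans_le hac
  refine div_le_div₀ (by positivity) ?_ (by positivity) ?_
  · gcongr
  · gcongr

/-- **The homogeneous Casher–Lebowitz chain conducts ballistically** (Rieder–Lebowitz–Lieb-type
lower bound, here for the unpinned chain with walls, arbitrary mass `c > 0` and friction `λ > 0`):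
`𝒢_n(c,…,c; λ) ≥ G(c, λ) > 0` for EVERY `n ≥ 1` — the transmission integral restricted to the
band window `1 ≤ cω² ≤ 3`, where the integrand is `≥ 3/(8c(1+3λ²c)²)`. [folklore] -/
theorem ballisticConst_le_clSpectralConductance {k : ℕ} {c lam : ℝ} (hc : 0 < c) (hlam : 0 < lam) :
    ballisticConst c lam ≤ clSpectralConductance (fun _ : Fin (k + 1) => c) lam := by
  set f : ℝ → ℝ := fun ω => ω ^ 2 / Complex.normSq (clImpedance (fun _ : Fin (k + 1) => c) lam ω).det
    with hf
  have hint : Integrable f := integrable_transmission (m := fun _ : Fin (k + 1) => c) (fun _ => hc) hlam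
  have hf0 : ∀ ω, 0 ≤ f ω := fun ω => div_nonneg (sq_nonneg ω) (Complex.normSq_nonneg _)
  set ω₁ : ℝ := 1 / Real.sqrt c with hω₁
  set ω₂ : ℝ := Real.sqrt 3 / Real.sqrt c with hω₂
  have hsc : 0 < Real.sqrt c := Real.sqrt_pos.mpr hc
  have hsc2 : Real.sqrt c ^ 2 = c := Real.sq_sqrt hc.le
  have hs3 : Real.sqrt 3 ^ 2 = 3 := Real.sq_sqrt (by norm_num)
  have hω₁pos : 0 < ω₁ := by rw [hω₁]; positivity
  have h12 : ω₁ ≤ ω₂ := by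
    rw [hω₁, hω₂]
    exact div_le_div_of_nonneg_right (sub_pos.mp sqrt_three_sub_one_pos).le hsc.le
  set g₀ : ℝ := 3 / (8 * c * (1 + 3 * lam ^ 2 * c) ^ 2) with hg₀
  -- pointwise bound on the window
  have hwin : ∀ ω ∈ Set.Icc ω₁ ω₂, g₀ ≤ f ω := by
    intro ω hω
    have hωpos : 0 < ω := hω₁pos.trans_le hω.1
    have hx1 : 1 ≤ c * ω ^ 2 := by
      have h1 : ω₁ ^ 2 ≤ ω ^ 2 := pow_le_pow_left₀ hω₁pos.le hω.1 2
      have : c * ω₁ ^ 2 = 1 := by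
        rw [hω₁, div_pow, one_pow, hsc2]
        field_simp
      nlinarith [mul_le_mul_of_nonneg_left h1 hc.le]
    have hx3 : c * ω ^ 2 ≤ 3 := by
      have h1 : ω ^ 2 ≤ ω₂ ^ 2 := pow_le_pow_left₀ hωpos.le hω.2 2
      have : c * ω₂ ^ 2 = 3 := by
        rw [hω₂, div_pow, hs3, hsc2]
        field_simp
      nlinarith [mul_le_mul_of_nonneg_left h1 hc.le]
    exact clSpectralIntegrand_const_ge hc hlam hωpos hx1 hx3
  -- integrate
  have hvol : volume (Set.Icc ω₁ ω₂) = ENNReal.ofReal (ω₂ - ω₁) := Real.volume_Icc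
  have hconst : ∫ _ in Set.Icc ω₁ ω₂, g₀ = (ω₂ - ω₁) * g₀ := by
    rw [setIntegral_const, measureReal_def, hvol, ENNReal.toReal_ofReal (sub_nonneg.mpr h12),
      smul_eq_mul]
  have hstep1 : (ω₂ - ω₁) * g₀ ≤ ∫ ω in Set.Icc ω₁ ω₂, f ω := by
    rw [← hconst]
    refine setIntegral_mono_on ?_ hint.integrableOn measurableSet_Icc hwin
    exact (integrableOn_const_iff (C := g₀)).mpr (Or.inr (by rw [hvol]; exact ENNReal.ofReal_lt_top))
  have hstep2 : ∫ ω in Set.Icc ω₁ ω₂, f ω ≤ ∫ ω, f ω :=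
    setIntegral_le_integral hint (ae_of_all _ hf0)
  have hwidth : ω₂ - ω₁ = (Real.sqrt 3 - 1) / Real.sqrt c := by
    rw [hω₁, hω₂, sub_div]
  -- assemble
  rw [clSpectralConductance_succ]
  show ballisticConst c lam ≤ lam ^ 2 * c * c / Real.pi * ∫ ω, f ω
  have hcoef : 0 < lam ^ 2 * c * c / Real.pi := by positivity
  calc ballisticConst c lam
      = lam ^ 2 * c * c / Real.pi * ((ω₂ - ω₁) * g₀) := by
        rw [hwidth, hg₀]
        have e := ballisticConst_sq (Real.sqrt c) lam hsc
        rw [hsc2] at e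
        exact e
    _ ≤ lam ^ 2 * c * c / Real.pi * ∫ ω in Set.Icc ω₁ ω₂, f ω :=
        mul_le_mul_of_nonneg_left hstep1 hcoef.le
    _ ≤ lam ^ 2 * c * c / Real.pi * ∫ ω, f ω :=
        mul_le_mul_of_nonneg_left hstep2 hcoef.le

end Literature.Barriers.AtomisticToContinuum.HeatConduction

namespace Literature.Barriers.AtomisticToContinuum

open Literature.MathematicalPhysics.KineticTheory.HeatConduction HeatConduction

/-! ### Identically distributed but comonotone masses: exponent `0` instead of `-3/2` -/

/-- The comonotone constant `G₀(a, b, λ) = 3(√3 - 1)λ²√a/(8π(1 + 3λ²b)²) ≤ inf_{c ∈ [a,b]} G(c, λ)`.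
[folklore] -/
def comonotoneConst (a b lam : ℝ) : ℝ :=
  3 * (Real.sqrt 3 - 1) * lam ^ 2 * Real.sqrt a / (8 * Real.pi * (1 + 3 * lam ^ 2 * b) ^ 2)

/-- `G₀(a, b, λ) > 0` for `a, b, λ > 0`. [folklore] -/
theorem comonotoneConst_pos {a b lam : ℝ} (ha : 0 < a) (hb : 0 < b) (hlam : 0 < lam) :
    0 < comonotoneConst a b lam := by
  unfold comonotoneConst
  have h3 : 0 < Real.sqrt 3 - 1 := sqrt_three_sub_one_pos
  have hsa : 0 < Real.sqrt a := Real.sqrt_pos.mpr ha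
  positivity

/-- **Identically distributed, comonotone masses conduct ballistically.** If all the masses of the
Casher–Lebowitz chain coincide, `M_1 = ⋯ = M_n = c` with `c` anywhere in `[a, b] ⊂ (0, ∞)` (the
diagonal coupling of ANY one-site law `ρ` on `[a, b]` — the same marginals as in
`AjankiHuveneers2011_scaling`, independence dropped), then for friction `λ > 0` and
`T_L ≥ T_R > 0` the stationary current (left-bath power in the Gaussian steady state of
`CasherLebowitz1971_steadyState_holds`, through `CasherLebowitz1971_currentFormula_holds`) obeys
`J_n(c,…,c) ≥ G₀(a, b, λ)(T_L - T_R)` for EVERY `n ≥ 1` and every realisation: no decay at all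
(Rieder–Lebowitz–Lieb behaviour), against `E J_n ≍ n^{-3/2}` for the product coupling.
[cite: AjankiHuveneers2011, §1 ("the energy current in a one-dimensional perfect harmonic crystal … is proportional to the difference of temperature")] -/
theorem comonotone_clLeftFlux_ge {a b : ℝ} (ha : 0 < a) {lam T_L T_R : ℝ}
    (hlam : 0 < lam) (hR : 0 < T_R) (hLR : T_R ≤ T_L) {n : ℕ} (hn : 1 ≤ n) {c : ℝ}
    (hc : c ∈ Set.Icc a b) :
    ∃ μ : Measure (PhaseSpace n), clIsSteadyState (fun _ : Fin n => c) lam T_L T_R μ ∧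
      comonotoneConst a b lam * (T_L - T_R) ≤ clLeftFlux (fun _ : Fin n => c) lam T_L μ := by
  obtain ⟨k, rfl⟩ : ∃ k, n = k + 1 := ⟨n - 1, by omega⟩
  have hcpos : 0 < c := ha.trans_le hc.1
  have hL : 0 < T_L := hR.trans_le hLR
  obtain ⟨μ, hst, hflux⟩ := exists_clIsSteadyState_clLeftFlux_eq CasherLebowitz1971_steadyState_holds
    CasherLebowitz1971_currentFormula_holds (fun _ : Fin (k + 1) => c) (fun _ => hcpos) hlam hL hR
  refine ⟨μ, hst, ?_⟩
  rw [hflux, mul_comm (T_L - T_R)]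
  exact mul_le_mul_of_nonneg_right
    ((ballisticConst_mono ha hc.1 hc.2 hlam).trans (ballisticConst_le_clSpectralConductance hcpos hlam))
    (sub_nonneg.mpr hLR)

/-- **The narrowed barrier** (barrier audit 2026-08-15 of `AjankiHuveneers2011_scaling`,
`DisorderedHarmonicChain.lean`). Two conjuncts, both PROVED (`DisorderedHarmonicChainNarrow_holds`):
(1) the catalogued fact — Ajanki–Huveneers 2011, Thm 1.1: `E J_n ≍ (T_L - T_R) n^{-3/2}` for i.i.d.
masses with a density of the §2 class between white-noise baths with fixed walls — reduced to the
single transmission-integral statement `AjankiHuveneers2011_spectralScaling` in which the paper proves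
it (the cluster's capstone `AjankiHuveneers2011_scaling_of_spectralScaling`); (2) independence is
load-bearing: with the SAME one-site law but comonotone (all-equal) masses the current is
`≥ G₀(a,b,λ)(T_L - T_R)` for every `n ≥ 1` — exponent `0`, not `-3/2`
(`comonotone_clLeftFlux_ge`). So of the catalogued technique class "quenched-disorder random-masses
…" the printed theorem covers the i.i.d., light-tailed sub-class only; the exponent is a functional
of the JOINT law of the masses (through the low-frequency Lyapunov spectrum), and the literature
read for the audit fills the gap between the two conjuncts with tunable exponents, including the
Fourier-like `-1` (BARRIER block below).
BARRIER (D-0021), AtomisticToContinuum/FouriersLaw (narrowing of `AjankiHuveneers2011_scaling`):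
technique_class: disorder as a substitute for anharmonicity in `d = 1` — i.i.d. (uncorrelated) isotopic disorder with a one-site density compactly supported in `(0, ∞)` (finite variance, masses bounded away from `0` and `∞`), nearest-neighbour harmonic chain without pinning, white-noise (Ornstein–Uhlenbeck) Langevin baths, MASS-AVERAGED stationary current [cite: AjankiHuveneers2011, Thm 1.1 and §2]; NOT covered although inside the catalogued wording "quenched-disorder random-masses anderson-localization": (i) correlated mass sequences (conjunct (2): the fully correlated extreme has exponent `0`; long-range correlations with power spectrum `W(μ) ∼ μ^β` are predicted to give `κ ∼ N^{(β-1)/(β+2)}` with fixed walls, `κ ∼ N^0` at `β = 1` [cite: HerreragonzalezIzrailevTessieri2015, §4 eq. for α and the case β = 1]), (ii) heavy-tailed / strong disorder reaching `0` (weak links `P(K) ∝ K^{ε-1}`: conductance `∝ L^{-1/2}, L^{-1/ε}, L^{-1}` for `ε > 2`, `1 < ε ≤ 2`, `ε ≤ 1` [cite: AmirOregImry2018, Table I and eqs. (18), (20), (23)] [cite: AshEtAl2020, Abstract and Conclusions]), (iii) `d ≥ 2`, (iv) almost-sure / typical-realisation statements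
blocks: normal conduction `E J_N ≍ N^{-1}` for the i.i.d. light-tailed disordered HARMONIC chain between white-noise baths with fixed walls (`E J_N ≍ N^{-3/2}`, conjunct (1), theorem) [cite: AjankiHuveneers2011, Thm 1.1]; with Rubin–Greer reservoirs `E J_N ≍ N^{-1/2}` (theorem) [cite: Verheggen1979, main result as restated in AjankiHuveneers2011 §1 and §6.3]; with white-noise baths and FREE boundaries `E J_N ∼ N^{-1/2}` (heuristics + numerics, no printed proof) [cite: Dhar2008, §3.4.1]; with on-site pinning at all sites `J_N ∼ e^{-cN}` almost surely (spectral gap + Furstenberg, PRL-level argument) [cite: DharLebowitz2008, paragraph "Considering now the random mass harmonic pinned case" (arXiv:0708.4171 p. 3)] [cite: Dhar2008, §3.4.1]; in the isolated i.i.d.-disordered unpinned chain the temperature profile is frozen on every time scale — "vanishing thermal diffusivity", the NESS power laws being carried by the low MECHANICAL modes (theorem, hyperbolic scaling; cited) [cite: BernardinHuveneersOlla2018, §1.2 and Thm 1]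
because: the current is `(T_L - T_R)(λ²m_1m_n/π)∫ω²|det Z_n(ω)|⁻²dω` (`CasherLebowitz1971_currentFormula_holds`); for i.i.d. masses `‖A_n⋯A_1‖ ∼ e^{γ(ω)n}` with `γ(ω) ≍ σ²ω²` as `ω → 0` (no pinning), so only `ω ≲ n^{-1/2}` transmits and the fixed-wall bath vectors weight that window into `n^{-3/2}` [cite: AjankiHuveneers2011, §1 and §6]; for a general stationary mass sequence the perturbative inverse localisation length is `(σ²/2M²)(ω/ω_max)² W(2ω/ω_max)` with `W` the disorder power spectrum [cite: HerreragonzalezIzrailevTessieri2015, §3 eq. for l_loc^{-1}], so the window — and the exponent — is a functional of the joint law: `W ≡ 1` (i.i.d.) gives `-3/2`, `W(μ) ∼ μ` gives `-1`, and the comonotone law (conjunct (2): `x(4-x)D_j² ≤ 4` on the band `x = cω² ∈ (0,4)`, `chainD_const_sq_le`) gives `0`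
evasions_known: (a)–(c) of `AjankiHuveneers2011_scaling` (bulk energy-conserving noise; anharmonicity + disorder, numerically; baths with other spectral functions — for the modified Casher–Lebowitz baths `μ̃(w) ∼ μ(sgn(w)|w|^s)` the law `E J ∼ n^{-(1+s/2)}` "can be proven rigorously by directly adapting the proof of Theorem 1.1", for the modified Rubin–Greer baths `n^{-(1+|s-1|)/2}` (Fourier-like at `s = 2`) it "does not follow directly" [cite: AjankiHuveneers2011, §6.3]); (d) long-range CORRELATED isotopic disorder with the same white-noise baths and fixed walls: "with a proper choice of correlations one can control how the conductivity κ scales with the chain length N … a size-independent conductivity is exactly recovered in the case of fixed boundary conditions" (binary correlator `χ(l) ∼ l^{-2}`, `W(μ) ∼ μ`, `N_e ∼ N^{2/3}` extended modes; Matsuda–Ishii weak-coupling formula + second-order Lyapunov exponent + numerics, `σ² = 0.2`, 100 realisations — not a theorem) [cite: HerreragonzalezIzrailevTessieri2015, Abstract, §4 and §5]; earlier: correlations delocalising a finite fraction of mid-spectrum modes give `κ ∝ N^α`, `α ∼ 1` [cite: HerreragonzalezIzrailevTessieri2010, Abstract and §1]; (e) HEAVY-TAILED i.i.d. weak-link disorder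 (harmonic leads, weak or strongly mismatched coupling): "for sufficiently strong disorder the thermal conductivity stops being anomalous" — `G ∝ L^{-1}` for `ε ≤ 1` (mode counting with Ziman/strong-disorder-RG scalings of DOS and localisation length; numerics) [cite: AmirOregImry2018, Abstract and Table I] [cite: AshEtAl2020, Abstract]; (f) DIMENSION: for the `d = 3` mass-disordered harmonic crystal with white-noise baths `J ∼ N^{-1}` is predicted for fixed boundaries and for pinning (`N^{-3/4}` free), "we numerically verify that the pinned three dimensional system satisfies Fourier's law while the two dimensional system is a heat insulator" (`d = 2`: `(ln N)^{-1/2}N^{-1}` fixed, `N^{-2/3}` free, `e^{-bN}` pinned; localisation + kinetic heuristics, numerics up to `N = 64`: "For all the parameter sets the exponent obtained is close to μ = 1") [cite: ChaudhuriEtAl2010, Abstract, §3 and §4.2.2]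
scope_caveats: conjunct (1) inherits every caveat of `AjankiHuveneers2011_scaling` (harmonic, `d = 1`, OU baths with fixed walls, §2 density class, mass-AVERAGED current, `K, K'` allowed to depend on `λ, T_L, T_R`, bounds for `n ≥ n₀`, existentially chosen weak steady states); conjunct (2) is the degenerate fully-correlated extreme (a random HOMOGENEOUS chain), proved here only as a witness that the i.i.d. hypothesis carries the exponent — it is not a model of impurity scattering; evasions (d)–(f) are physicist-level (perturbative Lyapunov exponents, weak-coupling Matsuda–Ishii / Landauer mode counting, numerics), none is a theorem, and (d)–(e) produce `J ≍ N^{-1}` by ballistic-mode counting, not by local equilibrium (cf. the frozen temperature profile of [cite: BernardinHuveneersOlla2018, §1.2]) — whether any correlated or heavy-tailed disordered harmonic chain satisfies the SCALING clause of `OscillatorChain.FouriersLawFor` (which has unit masses and so does not even parametrise disorder) is open on both sides; self-averaging (typical = average) is assumed, not proved, throughout the physics literature [cite: Dhar2008, §3.4.1]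
status: theorem (established) for both conjuncts: (1) [cite: AjankiHuveneers2011, Thm 1.1] via the cluster's reduction, (2) proved in this file [folklore]
[cite: AjankiHuveneers2011, Thm 1.1, §2 and §6.3] [cite: HerreragonzalezIzrailevTessieri2015, Abstract and §4] [cite: AmirOregImry2018, Table I] [cite: ChaudhuriEtAl2010, Abstract] [cite: BernardinHuveneersOlla2018, §1.2] -/
def DisorderedHarmonicChainNarrow : Prop :=
  (AjankiHuveneers2011_spectralScaling → AjankiHuveneers2011_scaling) ∧
    ∀ a b : ℝ, 0 < a → a ≤ b → ∀ lam T_L T_R : ℝ, 0 < lam → 0 < T_R → T_R ≤ T_L →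
      ∃ G₀ : ℝ, 0 < G₀ ∧ ∀ n : ℕ, 1 ≤ n → ∀ c ∈ Set.Icc a b,
        ∃ μ : Measure (PhaseSpace n), clIsSteadyState (fun _ : Fin n => c) lam T_L T_R μ ∧
          G₀ * (T_L - T_R) ≤ clLeftFlux (fun _ : Fin n => c) lam T_L μ

/-- **`DisorderedHarmonicChainNarrow` holds** (both conjuncts proved: the cluster's reduction of
Thm 1.1 to its spectral form, and the comonotone ballistic bound of this file). [folklore] -/
theorem DisorderedHarmonicChainNarrow_holds : DisorderedHarmonicChainNarrow :=
  ⟨AjankiHuveneers2011_scaling_of_spectralScaling, fun a b ha hab lam _ _ hlam hR hLR =>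
    ⟨comonotoneConst a b lam, comonotoneConst_pos ha (ha.trans_le hab) hlam,
      fun _ hn _ hc => comonotone_clLeftFlux_ge ha hlam hR hLR hn hc⟩⟩

/-- **The dichotomy, under the catalogued fact**: for one and the same one-site law `ρ = τ·Leb`
of the §2 class on `[a, b]`, the PRODUCT coupling's mass-averaged current (along the steady states
the fact provides) is eventually strictly below `G₀(T_L - T_R)`, while the COMONOTONE coupling's
current is at least `G₀(T_L - T_R)` at every length and every realisation `c ∈ [a, b]` — the
exponent of "the disordered harmonic chain" is a property of the joint law of the masses, not of
the marginal. [cite: AjankiHuveneers2011, Thm 1.1] -/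
theorem AjankiHuveneers2011_scaling.iid_eventually_lt_comonotone (h : AjankiHuveneers2011_scaling)
    (τ : ℝ → ℝ) {a b : ℝ} (ha : 0 < a) (hab : a < b) (h0 : ∀ s, 0 ≤ τ s)
    (hoff : ∀ s ∉ Set.Icc a b, τ s = 0) (hcont : ContinuousOn τ (Set.Icc a b))
    (hdiff : ContDiffOn ℝ 1 τ (Set.Ioo a b)) (hbd : ∃ C : ℝ, ∀ s ∈ Set.Ioo a b, |deriv τ s| ≤ C)
    (h1 : ∫ s, τ s = 1) (ρ : Measure ℝ) [IsProbabilityMeasure ρ]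
    (hρ : ρ = volume.withDensity (fun s => ENNReal.ofReal (τ s)))
    {lam T_L T_R : ℝ} (hlam : 0 < lam) (hR : 0 < T_R) (hLR : T_R < T_L) :
    ∃ G₀ : ℝ, 0 < G₀ ∧ ∃ n₁ : ℕ, ∀ n : ℕ, n₁ ≤ n →
      (∃ μ : (Fin n → ℝ) → Measure (PhaseSpace n),
        (∀ m : Fin n → ℝ, (∀ k, 0 < m k) → clIsSteadyState m lam T_L T_R (μ m)) ∧
          ∫ m, clLeftFlux m lam T_L (μ m) ∂(Measure.pi fun _ : Fin n => ρ) < G₀ * (T_L - T_R)) ∧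
      ∀ c ∈ Set.Icc a b, ∃ ν : Measure (PhaseSpace n),
        clIsSteadyState (fun _ : Fin n => c) lam T_L T_R ν ∧
          G₀ * (T_L - T_R) ≤ clLeftFlux (fun _ : Fin n => c) lam T_L ν := by
  obtain ⟨K, K', hK, hK', n₀, hn⟩ :=
    h τ a b ha hab h0 hoff hcont hdiff hbd h1 ρ hρ lam T_L T_R hlam hR hLR.le
  set G₀ := comonotoneConst a b lam with hG₀
  have hG : 0 < G₀ := comonotoneConst_pos ha (ha.trans hab) hlam
  have hδ : 0 < T_L - T_R := sub_pos.mpr hLR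
  refine ⟨G₀, hG, max n₀ (⌈K' / G₀⌉₊ + 1), fun n hn₁ => ⟨?_, fun c hc =>
    comonotone_clLeftFlux_ge ha hlam hR hLR.le
      (le_trans (by omega) ((le_max_right _ _).trans hn₁)) hc⟩⟩
  have hn₀ : n₀ ≤ n := (le_max_left _ _).trans hn₁
  have hnK : ⌈K' / G₀⌉₊ + 1 ≤ n := (le_max_right _ _).trans hn₁
  obtain ⟨μ, hst, -, -, hup⟩ := hn n hn₀
  refine ⟨μ, hst, lt_of_le_of_lt hup ?_⟩
  -- `K' δT / n^{3/2} < G₀ δT` since `n^{3/2} ≥ n > K'/G₀`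
  have hn1 : (1 : ℝ) ≤ n := by exact_mod_cast le_trans (by omega) hnK
  have hnpos : (0 : ℝ) < n := one_pos.trans_le hn1
  have hceil : K' / G₀ < n := by
    have h1 : K' / G₀ ≤ (⌈K' / G₀⌉₊ : ℝ) := Nat.le_ceil _
    have h2 : ((⌈K' / G₀⌉₊ + 1 : ℕ) : ℝ) ≤ n := by exact_mod_cast hnK
    push_cast at h2
    linarith
  have hpow : (n : ℝ) ≤ (n : ℝ) ^ (3 / 2 : ℝ) := Real.self_le_rpow_of_one_le hn1 (by norm_num)
  have hpowpos : (0 : ℝ) < (n : ℝ) ^ (3 / 2 : ℝ) := Real.rpow_pos_of_pos hnpos _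
  have hK'lt : K' < G₀ * (n : ℝ) ^ (3 / 2 : ℝ) := by
    have : K' < G₀ * n := by rwa [div_lt_iff₀ hG, mul_comm] at hceil
    exact this.trans_le (mul_le_mul_of_nonneg_left hpow hG.le)
  rw [div_lt_iff₀ hpowpos]
  calc K' * (T_L - T_R) < G₀ * (n : ℝ) ^ (3 / 2 : ℝ) * (T_L - T_R) :=
        mul_lt_mul_of_pos_right hK'lt hδ
    _ = G₀ * (T_L - T_R) * (n : ℝ) ^ (3 / 2 : ℝ) := by ring

end Literature.Barriers.AtomisticToContinuum
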